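import Summits.Ventures.LatticeQCDFlow.Exactness.IMHTauIntInfiniteOfWeightMoment
import Summits.Ventures.LatticeQCDFlow.Exactness.IMHTauIntLeInvESS
import Summits.Ventures.LatticeQCDFlow.Scoring.FreeFieldFlowESS
import Mathlib.Probability.Distributions.Gaussian.Real
import Mathlib.Analysis.SpecialFunctions.Gaussian.GaussianIntegral
import HarnessLib

/-!
# The free-field face of the dichotomy: a Gaussian model of a Gaussian mode has finite `τ_int` for every bounded observable iff `r > ½`

HONEST FRAMING: exact (Metropolis-corrected) sampling algorithms for lattice gauge theory;
figures of merit are autocorrelation/cost numbers at stated couplings and volumes; no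
continuum-physics claim.  (SCALAR calibration rung S0-A: not a gauge result.)

Venture `LatticeQCDFlow` (cell pub-lqcd), topic `Exactness`; FANOUT row 2 (`s0-phi4`, FLOW arm;
the exactness battery's FREE-FIELD LIMIT).  NEW WORK of the cell: the dichotomy of
`IMHTauIntInfiniteOfWeightMoment.lean` (every bounded centred observable of the exact flow sampler
has a summable autocovariance series iff `E_q[b²] < ∞`) evaluated on the calibration point the
battery uses — ONE free-field mode, target `p = N(0, a)`, model `q = N(0, b)` (row 2's
`Scoring/FreeFieldFlowESS.lean`: `E_q[w²] = b/√(a(2b − a))` for `2b > a`, else infinite).  Nothing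
is cited as a fact (Mathlib's Gaussian integrals).

## What is proved (`a, b > 0`, `r = b/a` the model-to-target variance ratio)

* `gaussMode_weightMoment_iff` — `∫ (p/q) p < ∞ ↔ a < 2b` (`p²/q ∝ e^{−(2b−a)x²/(2ab)}`);
* **`gaussMode_forall_summable_iff`** — for the exact independence sampler with target `p` and
  proposal `q` on `ℝ`: every bounded measurable centred observable has a summable
  autocovariance series IFF `a < 2b`, i.e. iff `r > ½`;
* **`gaussMode_tauInt_le`** — for `a < 2b` and every bounded centred `g` (`|g| ≤ B`):
  `τ_int(g) ≤ ½ + 12 B² (b/√(a(2b − a))) / ∫ g² p = ½ + 12 (B²/E_p[g²]) · r/√(2r − 1)`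
  (`IMHTauIntLeInvESS` with `Z = 1`, `W₂ = E_q[w²]` from `FreeFieldFlowESS`).

Reading for the battery (no numerics implied): three regimes of a mis-sized Gaussian flow on a
Gaussian mode — `r ≥ 1` (model at least as wide): bounded weights, uniformly ergodic,
`τ_int ≤ W − ½` (`FlowSamplerAutocorrelation`); `½ < r < 1`: unbounded weights, NOT geometrically
ergodic (Mengersen–Tweedie 1996, named only), yet EVERY bounded observable has finite `τ_int`
(`IMHTauIntFiniteOfWeightMoment`); `r ≤ ½`: the weight super-level indicators have a NON-SUMMABLE autocovariance series
(`τ_int = ∞` in the physicist's reading; Lean's `tsum` convention then returns `½`).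
The threshold `r = ½` is the same at which the reweighting ESS of `FreeFieldFlowESS` vanishes.
NOT CLAIMED: `λ > 0`, several modes, non-Gaussian flows, any number for a trained network.
-/

namespace Summit.Ventures.LatticeQCDFlow.Exactness

open Real MeasureTheory Filter Set Topology ProbabilityTheory
open Summit.Ventures.LatticeQCDFlow.Scoring

/-- **Second weight moment of a Gaussian model of a Gaussian mode**: with `p = N(0,a)`,
`q = N(0,b)` (`a, b > 0`), `∫ (p/q) p dx < ∞ ↔ a < 2b`. -/
theorem gaussMode_weightMoment_iff (a b : NNReal) (ha : a ≠ 0) (hb : b ≠ 0) :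
    Integrable (fun x => gaussianPDFReal 0 a x / gaussianPDFReal 0 b x * gaussianPDFReal 0 a x)
      ↔ (a : ℝ) < 2 * b := by
  have ha' : (0 : ℝ) < a := by exact_mod_cast pos_iff_ne_zero.mpr ha
  have hb' : (0 : ℝ) < b := by exact_mod_cast pos_iff_ne_zero.mpr hb
  have hC : 0 < Real.sqrt (2 * π * b) / (2 * π * a) := by positivity
  -- `(p/q) p = p²/q = C e^{−c x²}`
  have e : (fun x => gaussianPDFReal 0 a x / gaussianPDFReal 0 b x * gaussianPDFReal 0 a x)
      = fun x => Real.sqrt (2 * π * b) / (2 * π * a)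
        * Real.exp (-((2 * b - a) / (2 * a * b)) * x ^ 2) := by
    funext x
    rw [← gaussian_sq_div a b ha hb x]
    have hq : gaussianPDFReal 0 b x ≠ 0 := (gaussianPDFReal_pos 0 b x hb).ne'
    field_simp
  rw [e]
  constructor
  · intro h
    have h' : Integrable (fun x => Real.exp (-((2 * b - a) / (2 * a * b)) * x ^ 2)) := by
      have := h.const_mul (Real.sqrt (2 * π * b) / (2 * π * a))⁻¹
      refine this.congr (Eventually.of_forall fun x => ?_)
      show (Real.sqrt (2 * π * b) / (2 * π * a))⁻¹ * (Real.sqrt (2 * π * b) / (2 * π * a)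
        * Real.exp (-((2 * b - a) / (2 * a * b)) * x ^ 2))
        = Real.exp (-((2 * b - a) / (2 * a * b)) * x ^ 2)
      rw [← mul_assoc, inv_mul_cancel₀ hC.ne', one_mul]
    have hc : 0 < (2 * (b : ℝ) - a) / (2 * a * b) := integrable_exp_neg_mul_sq_iff.1 h'
    have h2ab : 0 < 2 * (a : ℝ) * b := by positivity
    have : 0 < 2 * (b : ℝ) - a := by
      by_contra hle
      have : (2 * (b : ℝ) - a) / (2 * a * b) ≤ 0 := div_nonpos_of_nonpos_of_nonneg (not_lt.1 hle) h2ab.le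
      linarith
    linarith
  · intro hab
    have hc : 0 < (2 * (b : ℝ) - a) / (2 * a * b) := by
      have : 0 < 2 * (b : ℝ) - a := by linarith
      positivity
    exact (integrable_exp_neg_mul_sq hc).const_mul _

/-- **THE FREE-FIELD FACE OF THE DICHOTOMY.**  The exact independence sampler on `ℝ` with target
density `p = N(0, a)` and Gaussian model `q = N(0, b)` (`a, b > 0`; `r = b/a`): every bounded
measurable centred observable (`∫ g p = 0`) has a summable autocovariance series along the chain
IF AND ONLY IF `a < 2b` (`r > ½`) — the threshold at which the reweighting ESS vanishes. -/
theorem gaussMode_forall_summable_iff (a b : NNReal) (ha : a ≠ 0) (hb : b ≠ 0) :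
    (∀ (g : ℝ → ℝ) (B : ℝ), Measurable g → (∀ t, |g t| ≤ B) →
        ∫ x, g x * gaussianPDFReal 0 a x = 0 →
        Summable fun k => ∫ x, g x
          * ((imhOp volume (gaussianPDFReal 0 a) (gaussianPDFReal 0 b))^[k + 1] g) x
          * gaussianPDFReal 0 a x)
      ↔ (a : ℝ) < 2 * b := by
  rw [← gaussMode_weightMoment_iff a b ha hb]
  exact forall_summable_autocov_iff (μ := volume) (fun x => gaussianPDFReal_pos 0 a x ha)
    (measurable_gaussianPDFReal 0 a) (integrable_gaussianPDFReal 0 a)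
    (fun x => gaussianPDFReal_pos 0 b x hb) (measurable_gaussianPDFReal 0 b)
    (integrable_gaussianPDFReal 0 b) (integral_gaussianPDFReal_eq_one 0 hb)

/-- **`τ_int ≤ ½ + 12 (B²/E_p[g²]) · r/√(2r − 1)` on a Gaussian mode.**  Target `p = N(0, a)`,
Gaussian model `q = N(0, b)` with `a < 2b`; `g` measurable, `|g| ≤ B`, `∫ g p = 0`.  Then along the
exact independence sampler `τ_int(g) ≤ ½ + 12 B² (b/√(a(2b − a))) / ∫ g² p dx`. -/
theorem gaussMode_tauInt_le (a b : NNReal) (ha : a ≠ 0) (hb : b ≠ 0) (hab : (a : ℝ) < 2 * b)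
    {g : ℝ → ℝ} (hgm : Measurable g) {B : ℝ} (hgb : ∀ t, |g t| ≤ B)
    (hg0 : ∫ x, g x * gaussianPDFReal 0 a x = 0) :
    tauInt (fun k => (∫ x, g x
        * ((imhOp volume (gaussianPDFReal 0 a) (gaussianPDFReal 0 b))^[k] g) x
        * gaussianPDFReal 0 a x) / ∫ x, g x ^ 2 * gaussianPDFReal 0 a x)
      ≤ 1 / 2 + 12 * B ^ 2 * ((b : ℝ) / Real.sqrt (a * (2 * b - a)))
          / ∫ x, g x ^ 2 * gaussianPDFReal 0 a x := by
  have hW₂ := (gaussMode_weightMoment_iff a b ha hb).2 hab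
  have h := imhOp_tauInt_le_invESS (μ := volume) (fun x => gaussianPDFReal_pos 0 a x ha)
    (measurable_gaussianPDFReal 0 a) (integrable_gaussianPDFReal 0 a)
    (fun x => gaussianPDFReal_pos 0 b x hb) (measurable_gaussianPDFReal 0 b)
    (integrable_gaussianPDFReal 0 b) (integral_gaussianPDFReal_eq_one 0 hb) hW₂ hgm hgb hg0
  have e1 : ∫ x, gaussianPDFReal 0 a x / gaussianPDFReal 0 b x * gaussianPDFReal 0 a x
      = (b : ℝ) / Real.sqrt (a * (2 * b - a)) := by
    rw [← gaussian_weight_sq_moment a b ha hb hab]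
    refine integral_congr_ae (Eventually.of_forall fun x => ?_)
    have hq : gaussianPDFReal 0 b x ≠ 0 := (gaussianPDFReal_pos 0 b x hb).ne'
    show gaussianPDFReal 0 a x / gaussianPDFReal 0 b x * gaussianPDFReal 0 a x
      = gaussianPDFReal 0 a x ^ 2 / gaussianPDFReal 0 b x
    field_simp
  rw [e1, integral_gaussianPDFReal_eq_one 0 ha, div_one] at h
  exact h

end Summit.Ventures.LatticeQCDFlow.Exactness
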